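import Literature.AnabelianGeometry.SemiGraphs.TemperedPiSystem
import Literature.AnabelianGeometry.SemiGraphs.FiniteCoveringsGalois
import Literature.AnabelianGeometry.SemiGraphs.PiPresentationBridge
import Literature.AnabelianGeometry.Anabelioids.GaloisTower

/-!
# Galois level data from the hypotheses of Proposition 3.6 ([SemiAnbd] §3 p. 38)

For `𝒢` satisfying the hypotheses of [SemiAnbd] Prop. 3.6 (`Prop36Hypotheses`: connected,
countable, Galois-countable, with a vertex, …) this file constructs Galois level data
(`TemperedPiSystem.lean`): in the Galois category `B(𝒢)` of the semi-graph of anabelioids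
`{B(Π_v), B(Π_e), B(b_*)}` (`galoisCategory_bObj`, fibre functor at a vertex `v₀`) take the Galois
tower (`galoisTower`) over the countable family of finite coverings given by Galois-countability,
transport it to `B^cov(𝒢)` (`ofBObj`), verify point-transitivity from the Galois property through
the fibre functors at every vertex, and choose compatible base vertex-orbits (transition maps are
surjective on fibres).  Consequently **`π₁^temp(𝒢)` exists and is tempered** (`temperedPi`,
`isTempered_temperedPi`) — [SemiAnbd] Prop. 3.6 (i) for the constructed group.
-/

namespace Literature.AnabelianGeometry.SemiGraphs

namespace ProfiniteSemiGraph

open CategoryTheory CategoryTheory.PreGaloisCategory Literature.AnabelianGeometry.Anabelioids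
open scoped FintypeCatDiscrete

universe u

variable (𝒢 : ProfiniteSemiGraph.{u}) (h36 : 𝒢.Prop36Hypotheses)

/-- The fibre functor of `B(𝒢)` "points over the vertex `v`": `X ↦ (X.S v)` as a finite set.
[cite: MochizukiSemiAnbd2006, Def. 2.1 p.23] -/
noncomputable abbrev fiberAt (v : 𝒢.graph.Vertex) : 𝒢.toAnab.BObj ⥤ FintypeCat.{u} :=
  𝒢.toAnab.ρ v ⋙ (ObjectProperty.ι (Action.IsContinuous (V := FintypeCat.{u}) (G := 𝒢.Gv v)) ⋙
    Action.forget FintypeCat.{u} (𝒢.Gv v))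

/-- `fiberAt v` is a fibre functor of the Galois category `B(𝒢)` (for connected `𝒢`).
[cite: MochizukiSemiAnbd2006, Def. 2.1 p.23] -/
theorem fiberFunctor_fiberAt (hc : 𝒢.graph.IsConnected) (v : 𝒢.graph.Vertex) :
    letI := SemiGraphOfAnabelioids.galoisCategory_bObj 𝒢.toAnab ⟨hc⟩
    FiberFunctor (𝒢.fiberAt v) := by
  letI := SemiGraphOfAnabelioids.galoisCategory_bObj 𝒢.toAnab ⟨hc⟩
  exact @SemiGraphOfAnabelioids.fiberFunctor_ρ 𝒢.toAnab ⟨hc⟩ v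
    (ObjectProperty.ι (Action.IsContinuous (V := FintypeCat.{u}) (G := 𝒢.Gv v)) ⋙
      Action.forget FintypeCat.{u} (𝒢.Gv v)) (by exact fiberFunctor_forget_bCat (𝒢.Gv v))

/-- Endomorphisms of a connected Galois object of `B(𝒢)`, transported to `B^cov(𝒢)`, act
transitively on every fibre `S_v`. [cite: MochizukiSemiAnbd2006, Prop 3.6 p.38] -/
theorem htrans_of_isGalois (hc : 𝒢.graph.IsConnected) (A : 𝒢.toAnab.BObj)
    (hA : letI := SemiGraphOfAnabelioids.galoisCategory_bObj 𝒢.toAnab ⟨hc⟩; IsGalois A)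
    (v : 𝒢.graph.Vertex) (x x' : ((𝒢.ofBObj.obj A).SV v).obj.V) :
    ∃ σ : 𝒢.ofBObj.obj A ⟶ 𝒢.ofBObj.obj A, (σ.fV v).hom.hom x = x' := by
  letI := SemiGraphOfAnabelioids.galoisCategory_bObj 𝒢.toAnab ⟨hc⟩
  haveI := 𝒢.fiberFunctor_fiberAt hc v
  haveI := hA
  haveI : MulAction.IsPretransitive (Aut A) ((𝒢.fiberAt v).obj A) :=
    (isGalois_iff_pretransitive (𝒢.fiberAt v) A).mp hA
  obtain ⟨σ, hσ⟩ := @MulAction.exists_smul_eq (Aut A) ((𝒢.fiberAt v).obj A) _ _ x x'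
  exact ⟨𝒢.ofBObj.map σ.hom, hσ⟩

/-- The sequence of finite objects of `B(𝒢)` underlying a Galois-countability witness.
[cite: Mochizuki2012, IUTchI Rmk 2.5.3 (i) (T2), p. 52] -/
noncomputable def gcFamily (hgc : 𝒢.IsGaloisCountable) (n : ℕ) : 𝒢.toAnab.BObj :=
  toBObjObj (hgc.2.choose n) (hgc.2.choose_spec.1 n).1

/-- The fibres at `v₀` of the Galois-countability family are nonempty.
[cite: Mochizuki2012, IUTchI Rmk 2.5.3 (i) (T2), p. 52] -/
theorem nonempty_fiberAt_gcFamily (hgc : 𝒢.IsGaloisCountable) (v₀ : 𝒢.graph.Vertex) (n : ℕ) :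
    Nonempty ((𝒢.fiberAt v₀).obj (𝒢.gcFamily hgc n)) :=
  (hgc.2.choose_spec.1 n).2.nonempty_V v₀

/-- A base vertex of `𝒢` (from `HasVertex`). [cite: MochizukiSemiAnbd2006, Prop 3.6 p.38] -/
noncomputable def baseVertex : 𝒢.graph.Vertex := Classical.choice h36.hasVertex

/-- **The Galois tower of `𝒢`** in `B(𝒢)`: connected Galois finite étale coverings
`A 0 ⟵ A 1 ⟵ ⋯` dominating the Galois-countability family ([SemiAnbd] p. 38 "cofinal collection
of connected finite étale Galois coverings"). [cite: MochizukiSemiAnbd2006, Prop 3.6 p.38] -/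
noncomputable def tower (n : ℕ) : 𝒢.toAnab.BObj :=
  letI := SemiGraphOfAnabelioids.galoisCategory_bObj 𝒢.toAnab ⟨h36.isConnected⟩
  haveI := 𝒢.fiberFunctor_fiberAt h36.isConnected (𝒢.baseVertex h36)
  galoisTower (𝒢.fiberAt (𝒢.baseVertex h36)) (𝒢.gcFamily h36.isGaloisCountable)
    (𝒢.nonempty_fiberAt_gcFamily h36.isGaloisCountable (𝒢.baseVertex h36)) n

/-- The tower consists of Galois objects. [cite: MochizukiSemiAnbd2006, Prop 3.6 p.38] -/
theorem isGalois_tower (n : ℕ) :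
    letI := SemiGraphOfAnabelioids.galoisCategory_bObj 𝒢.toAnab ⟨h36.isConnected⟩
    IsGalois (𝒢.tower h36 n) := by
  letI := SemiGraphOfAnabelioids.galoisCategory_bObj 𝒢.toAnab ⟨h36.isConnected⟩
  haveI := 𝒢.fiberFunctor_fiberAt h36.isConnected (𝒢.baseVertex h36)
  exact isGalois_galoisTower _ _ _ n

/-- The transition maps of the tower. [cite: MochizukiSemiAnbd2006, Prop 3.6 p.38] -/
noncomputable def towerMap (n : ℕ) : 𝒢.tower h36 (n + 1) ⟶ 𝒢.tower h36 n :=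
  letI := SemiGraphOfAnabelioids.galoisCategory_bObj 𝒢.toAnab ⟨h36.isConnected⟩
  haveI := 𝒢.fiberFunctor_fiberAt h36.isConnected (𝒢.baseVertex h36)
  galoisTowerMap (𝒢.fiberAt (𝒢.baseVertex h36)) (𝒢.gcFamily h36.isGaloisCountable)
    (𝒢.nonempty_fiberAt_gcFamily h36.isGaloisCountable (𝒢.baseVertex h36)) n

/-- The transition maps are surjective on every fibre `S_v` (epimorphisms between connected
objects of a Galois category are surjective on fibres). [cite: MochizukiSemiAnbd2006, Prop 3.6 p.38] -/
theorem towerMap_fV_surjective (n : ℕ) (v : 𝒢.graph.Vertex) :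
    Function.Surjective ((𝒢.ofBObj.map (𝒢.towerMap h36 n)).fV v).hom.hom := by
  letI := SemiGraphOfAnabelioids.galoisCategory_bObj 𝒢.toAnab ⟨h36.isConnected⟩
  haveI := 𝒢.fiberFunctor_fiberAt h36.isConnected v
  haveI := 𝒢.isGalois_tower h36 n
  haveI := 𝒢.isGalois_tower h36 (n + 1)
  haveI : Epi (𝒢.towerMap h36 n) := epi_of_nonempty_of_isConnected (𝒢.fiberAt v) _
  exact surjective_on_fiber_of_epi (𝒢.fiberAt v) (𝒢.towerMap h36 n)

/-- Compatible base points over the base vertex along the tower (chosen recursively, using the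
fibre-surjectivity of the transition maps). [cite: MochizukiSemiAnbd2006, Prop 3.6 p.38] -/
noncomputable def basePoint : ∀ n : ℕ, ((𝒢.ofBObj.obj (𝒢.tower h36 n)).SV (𝒢.baseVertex h36)).obj.V
  | 0 =>
    letI := SemiGraphOfAnabelioids.galoisCategory_bObj 𝒢.toAnab ⟨h36.isConnected⟩
    haveI := 𝒢.fiberFunctor_fiberAt h36.isConnected (𝒢.baseVertex h36)
    haveI := 𝒢.isGalois_tower h36 0
    Classical.choice (nonempty_fiber_of_isConnected (𝒢.fiberAt (𝒢.baseVertex h36)) (𝒢.tower h36 0))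
  | n + 1 => (𝒢.towerMap_fV_surjective h36 n (𝒢.baseVertex h36) (basePoint n)).choose

/-- Compatibility of the chosen base points. [cite: MochizukiSemiAnbd2006, Prop 3.6 p.38] -/
theorem basePoint_succ (n : ℕ) :
    ((𝒢.ofBObj.map (𝒢.towerMap h36 n)).fV (𝒢.baseVertex h36)).hom.hom (𝒢.basePoint h36 (n + 1)) =
      𝒢.basePoint h36 n :=
  (𝒢.towerMap_fV_surjective h36 n (𝒢.baseVertex h36) (𝒢.basePoint h36 n)).choose_spec

/-- **Galois level data for `𝒢` under the hypotheses of Proposition 3.6.**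
[cite: MochizukiSemiAnbd2006, Prop 3.6 p.38] -/
noncomputable def galoisLevelData : GaloisLevelData 𝒢 where
  S := fun n => 𝒢.ofBObj.obj (𝒢.tower h36 n)
  g := fun n => 𝒢.ofBObj.map (𝒢.towerMap h36 n)
  htrans := fun n v x x' => 𝒢.htrans_of_isGalois h36.isConnected _ (𝒢.isGalois_tower h36 n) v x x'
  v₀ := 𝒢.baseVertex h36
  x := 𝒢.basePoint h36
  hx := 𝒢.basePoint_succ h36

/-- **The tempered fundamental group `π₁^temp(𝒢)`** of a semi-graph of anabelioids satisfying the
hypotheses of [SemiAnbd] Proposition 3.6 ("`π₁^temp(𝒢) := lim_i Gal(𝒢_{∞,i}/𝒢)`", p. 38).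
[cite: MochizukiSemiAnbd2006, Prop 3.6(i) p.38] -/
noncomputable def temperedPi : Type u :=
  (𝒢.galoisLevelData h36).temperedPi h36.isCountable

/-- Group structure. [cite: MochizukiSemiAnbd2006, Prop 3.6(i) p.38] -/
noncomputable instance : Group (𝒢.temperedPi h36) :=
  inferInstanceAs (Group ((𝒢.galoisLevelData h36).temperedPi h36.isCountable))

/-- Topology. [cite: MochizukiSemiAnbd2006, Prop 3.6(i) p.38] -/
noncomputable instance : TopologicalSpace (𝒢.temperedPi h36) :=
  inferInstanceAs (TopologicalSpace ((𝒢.galoisLevelData h36).temperedPi h36.isCountable))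

/-- Topological group. [cite: MochizukiSemiAnbd2006, Prop 3.6(i) p.38] -/
instance : IsTopologicalGroup (𝒢.temperedPi h36) :=
  inferInstanceAs (IsTopologicalGroup ((𝒢.galoisLevelData h36).temperedPi h36.isCountable))

/-- `π₁^temp(𝒢)` is second countable. [cite: MochizukiSemiAnbd2006, Prop 3.6(i) p.38] -/
instance : SecondCountableTopology (𝒢.temperedPi h36) :=
  inferInstanceAs (SecondCountableTopology ((𝒢.galoisLevelData h36).temperedPi h36.isCountable))

/-- **[SemiAnbd] Proposition 3.6 (i), for the constructed group: `π₁^temp(𝒢)` is tempered.**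
[cite: MochizukiSemiAnbd2006, Prop 3.6(i) p.38] -/
theorem isTempered_temperedPi : IsTempered (𝒢.temperedPi h36) :=
  (𝒢.galoisLevelData h36).isTempered_temperedPi h36.isCountable

end ProfiniteSemiGraph

end Literature.AnabelianGeometry.SemiGraphs
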